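import Mathlib.RingTheory.ZMod.UnitsCyclic
import Mathlib.RingTheory.RootsOfUnity.PrimitiveRoots
import Mathlib.NumberTheory.DirichletCharacter.Basic
import HarnessLib

/-!
# Characters of the layers `Gal(ℚ_n/ℚ) = (ℤ/2^{n+2})ˣ/{±1}` of the cyclotomic `ℤ₂`-tower as EVEN Dirichlet
# characters mod `2^{n+2}`: the unit group is `±⟨5⟩`, even characters are determined by their value at `5`,
# faithful even characters are PRIMITIVE and exist at every level (THEOREMS ONLY; the `p = 2` twin of
# `Kato2004/LayerCharacterCuspFactorProofs.lean` §1–§2)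

Topic `NumberTheory/EllipticCurves`, sub-directory `Kato2004`. THEOREMS ONLY (0 def, 0 fact, 0 instance, 0 sorry).
Cell `bsd-2adic`, seat `bsd-2adic-addL2x` (GEN 20; crux stmt-BirchSwinnertonDyer-19098 `AdditiveRankZeroAtTwo`, child
C4″ stmt-BirchSwinnertonDyer-22618). Companion of `CyclotomicZpExtensionLayerTorsionTwoProofs.lean` (the image of
`Gal(ℚ̄/ℚ_n)` in `(ℤ/2^{n+2})ˣ` is `{±1}`; the image of a topological generator generates the quotient). Consumers:
the `p = 2` twins of `Kato2004/ZetaBodyLayerValuesProofs.lean` / `EulerSystemClassNonvanishingRohrlichProofs.lean`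
(Kato Thm. 12.5 (1) ⇐ Rohrlich at `p = 2`: a primitive EVEN character of every large level `2^{n+2}` is needed) and
the finite-level eigenfunctionals of `IwasawaH1CharacterFunctionalProofs.lean` (two even characters with the same
value at a generator coincide). HONEST FRAMING: elementary character theory of `(ℤ/2^{n+2})ˣ = {±1} × ⟨5⟩`
(Gauss); nothing about `L`-values, Euler systems or BSD is asserted.

## What

For `M = 2^{n+2}` and `g ∈ (ℤ/M)ˣ` the unit with `g = 5` (Mathlib `ZMod.orderOf_five`: `5` has order `2^n`):
* §1 `pow_five_ne_neg` — `g^k ≠ −g^l` (reduce mod `4`: `5 ≡ 1`, `−1 ≢ 1`); `exists_eq_five_pow_or_eq_neg_five_pow` —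
  **every unit is `g^k` or `−g^k` with `k < 2^n`** (the map `(ε, k) ↦ ε g^k` on `{±1} × [0, 2^n)` is injective and
  both sides have `2^{n+1} = φ(2^{n+2})` elements).
* §2 `eq_of_even_of_apply_five_eq` — two EVEN Dirichlet characters mod `M` (values in any commutative monoid with
  zero) with the same value at `g` are EQUAL; `isPrimitive_of_pow_eq_of_pow_eq` — characters that are powers of each
  other have the same conductor (Mathlib `conductor_pow_dvd`), so primitivity passes between them.
* §3 `isPrimitive_of_even_of_apply_five` — an even character mod `2^{n+2}` (`n ≥ 1`) whose value at `g` is a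
  PRIMITIVE `2^n`-th root of unity is primitive of conductor `2^{n+2}`: `g^{2^{n−1}}` dies in `(ℤ/2^{n+1})ˣ`
  (`5^{2^{n−1}} ≡ 1 (mod 2^{n+1})`) but `χ(g)^{2^{n−1}} ≠ 1`; `exists_even_isPrimitive_apply_five_eq` — over any
  commutative ring with a primitive `2^n`-th root of unity `η` there IS an even character mod `2^{n+2}` with
  `χ(g) = η`, primitive when `n ≥ 1` (`χ(±g^k) := η^k`, well defined by §1).
* §4 (any modulus `N`) `conductor_ringHomComp` / `isPrimitive_ringHomComp_iff` / `even_ringHomComp_iff` — conductor,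
  primitivity and parity are unchanged by an INJECTIVE change of coefficient ring; `exists_ringHomComp_eq` — along an
  injective `ι : F → K` into a domain, every `K`-valued character mod `N` LIFTS to an `F`-valued one as soon as `F`
  has a primitive `e`-th root of unity with `b^e = 1` on `(ℤ/N)ˣ` (used with `F = ℚ(ζ_m) → ℂ_p`, `ℚ(ζ_m) → ℂ`).

References: L. C. Washington, *Introduction to Cyclotomic Fields* (1997) §13.1 (`ℚ_n = ℚ(ζ_{2^{n+2}})⁺`,
`Gal(ℚ(ζ_{2^{n+2}})/ℚ_n) = {±1}`), Ch. 3 (conductors) [Washington1997]; C. F. Gauss, *Disquisitiones* art. 90–91 /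
J.-P. Serre, *A Course in Arithmetic* II §3.2 (`(ℤ/2^m)ˣ = {±1} × ⟨5⟩`) [Serre1973]; K. Kato, Astérisque 295 (2004)
Thm. 12.5 (1) p. 222 («by a theorem of Rohrlich … for almost all characters `χ` of `Gal(ℚ(ζ_{p^∞})/ℚ)`»)
[Kato2004Asterisque].
-/

set_option autoImplicit false

noncomputable section

open scoped BigOperators
open Finset

namespace Literature.NumberTheory.EllipticCurves.Kato2004

namespace LayerCharacterTwo

/-! ## §1 The unit group `(ℤ/2^{n+2})ˣ = ±⟨5⟩` -/

section Units

variable {n : ℕ} {M : ℕ} [NeZero M]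

omit [NeZero M] in
/-- `5` is a unit mod `2^{n+2}`. [cite: Serre1973, Ch. II §3.2 Prop. 8] -/
theorem exists_unit_eq_five (hM : M = 2 ^ (n + 2)) : ∃ g : (ZMod M)ˣ, (g : ZMod M) = 5 := by
  have hcop : Nat.Coprime 5 M := by
    rw [hM]
    exact Nat.Coprime.pow_right _ (by norm_num)
  exact ⟨ZMod.unitOfCoprime 5 hcop, by rw [ZMod.coe_unitOfCoprime]; norm_cast⟩

/-- The unit `5` of `ℤ/2^{n+2}` has order `2^n` (Gauss; Mathlib `ZMod.orderOf_five`).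
[cite: Serre1973, Ch. II §3.2 Prop. 8] -/
theorem orderOf_unit_five (hM : M = 2 ^ (n + 2)) {g : (ZMod M)ˣ} (hg : (g : ZMod M) = 5) :
    orderOf g = 2 ^ n := by
  subst hM
  rw [← orderOf_units, hg]
  exact ZMod.orderOf_five n

/-- `g^k ≠ −g^l` in `(ℤ/2^{n+2})ˣ` for `g = 5`: modulo `4`, `5^k ≡ 1` while `−5^l ≡ −1 ≢ 1`.
[cite: Serre1973, Ch. II §3.2 Prop. 8] -/
theorem pow_five_ne_neg_pow (hM : M = 2 ^ (n + 2)) {g : (ZMod M)ˣ} (hg : (g : ZMod M) = 5) (k l : ℕ) :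
    g ^ k ≠ -(g ^ l) := by
  subst hM
  intro h
  have h4 : (4 : ℕ) ∣ 2 ^ (n + 2) := ⟨2 ^ n, by ring⟩
  have hcast := congrArg (fun u : (ZMod (2 ^ (n + 2)))ˣ ↦ ZMod.castHom h4 (ZMod 4) (u : ZMod (2 ^ (n + 2)))) h
  simp only [Units.val_pow_eq_pow_val, Units.val_neg, map_pow, map_neg, hg] at hcast
  have h5 : ZMod.castHom h4 (ZMod 4) (5 : ZMod (2 ^ (n + 2))) = 1 := by
    rw [show (5 : ZMod (2 ^ (n + 2))) = ((5 : ℕ) : ZMod (2 ^ (n + 2))) by norm_cast, map_natCast]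
    decide
  rw [h5, one_pow, one_pow] at hcast
  exact absurd hcast (by decide)

/-- **`(ℤ/2^{n+2})ˣ = ±⟨5⟩`**: every unit `b` is `g^k` or `−g^k` for some `k < 2^n` (`g = 5`). The map
`(ε, k) ↦ ε·g^k` on `{±1} × [0, 2^n)` is injective (`g` has order `2^n`, and `g^k ≠ −g^l`) between sets of the
same size `2^{n+1} = φ(2^{n+2})`, hence onto. [cite: Serre1973, Ch. II §3.2 Prop. 8] -/
theorem exists_eq_five_pow_or_eq_neg_five_pow (hM : M = 2 ^ (n + 2)) {g : (ZMod M)ˣ}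
    (hg : (g : ZMod M) = 5) (b : (ZMod M)ˣ) :
    ∃ k : ℕ, k < 2 ^ n ∧ (b = g ^ k ∨ b = -(g ^ k)) := by
  have hord := orderOf_unit_five hM hg
  have hne := pow_five_ne_neg_pow hM hg
  subst hM
  -- the map `(ε, k) ↦ ε g^k`
  set f : Bool × Fin (2 ^ n) → (ZMod (2 ^ (n + 2)))ˣ :=
    fun x ↦ if x.1 then -(g ^ (x.2 : ℕ)) else g ^ (x.2 : ℕ) with hf
  have hinj_pow : ∀ k l : Fin (2 ^ n), g ^ (k : ℕ) = g ^ (l : ℕ) → k = l := by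
    intro k l h
    have := pow_injOn_Iio_orderOf (x := g) (by rw [Set.mem_Iio, hord]; exact k.2)
      (by rw [Set.mem_Iio, hord]; exact l.2) h
    exact Fin.ext this
  have hinj : Function.Injective f := by
    rintro ⟨ε, k⟩ ⟨ε', l⟩ h
    cases ε <;> cases ε' <;> simp only [hf, Bool.false_eq_true, ↓reduceIte] at h
    · exact Prod.ext rfl (hinj_pow k l h)
    · exact absurd h (hne k l)
    · exact absurd h.symm (hne l k)
    · exact Prod.ext rfl (hinj_pow k l (neg_inj.mp h))
  have hcard : Fintype.card (Bool × Fin (2 ^ n)) = Fintype.card (ZMod (2 ^ (n + 2)))ˣ := by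
    rw [Fintype.card_prod, Fintype.card_bool, Fintype.card_fin, ZMod.card_units_eq_totient,
      Nat.totient_prime_pow Nat.prime_two (by omega)]
    simp [pow_succ]; ring
  have hbij : Function.Bijective f := (Fintype.bijective_iff_injective_and_card f).mpr ⟨hinj, hcard⟩
  obtain ⟨⟨ε, k⟩, hk⟩ := hbij.2 b
  refine ⟨k, k.2, ?_⟩
  cases ε
  · left; rw [← hk]; simp [hf]
  · right; rw [← hk]; simp [hf]

end Units

/-! ## §2 Even characters mod `2^{n+2}` are determined by their value at `5`; powers and primitivity -/

section Even

variable {R : Type*} [CommRing R] {n : ℕ} {M : ℕ} [NeZero M]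

/-- **Two EVEN Dirichlet characters mod `2^{n+2}` with the same value at `g = 5` are EQUAL** (every unit is
`±g^k`; values in any commutative ring). [cite: Washington1997, §13.1] -/
theorem eq_of_even_of_apply_five_eq (hM : M = 2 ^ (n + 2)) {g : (ZMod M)ˣ} (hg : (g : ZMod M) = 5)
    {χ ψ : DirichletCharacter R M} (hχ : χ.Even) (hψ : ψ.Even) (h : χ g = ψ g) : χ = ψ := by
  refine MulChar.ext fun b ↦ ?_
  obtain ⟨k, -, hb⟩ := exists_eq_five_pow_or_eq_neg_five_pow hM hg b
  have hpow : χ ((g ^ k : (ZMod M)ˣ) : ZMod M) = ψ ((g ^ k : (ZMod M)ˣ) : ZMod M) := by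
    rw [Units.val_pow_eq_pow_val, map_pow, map_pow, h]
  rcases hb with rfl | rfl
  · exact hpow
  · rw [Units.val_neg, hχ.eval_neg, hψ.eval_neg, hpow]

variable {S : Type*} [CommRing S]

/-- Characters that are powers of each other have the same conductor (Mathlib `conductor_pow_dvd` both ways); in
particular **primitivity passes from `χ` to `ψ` when `χ = ψ^a` and `ψ = χ^b`.** [cite: Washington1997, Ch. 3 (conductors)] -/
theorem isPrimitive_of_pow_eq_of_pow_eq {N : ℕ} {χ ψ : DirichletCharacter S N} (hχ : χ.IsPrimitive)
    {a b : ℕ} (ha : ψ ^ a = χ) (hb : χ ^ b = ψ) : ψ.IsPrimitive := by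
  rw [DirichletCharacter.isPrimitive_def] at hχ ⊢
  have h1 : ψ.conductor ∣ χ.conductor := by rw [← hb]; exact DirichletCharacter.conductor_pow_dvd χ b
  have h2 : χ.conductor ∣ ψ.conductor := by rw [← ha]; exact DirichletCharacter.conductor_pow_dvd ψ a
  have h3 := Nat.dvd_antisymm h1 h2
  rw [h3, hχ]

/-- A power of an even character is even. [cite: Washington1997, Ch. 3] -/
theorem even_pow {N : ℕ} {χ : DirichletCharacter S N} (hχ : χ.Even) (a : ℕ) : (χ ^ a).Even := by
  change (χ ^ a) (-1) = 1
  have h : ((-1 : (ZMod N)ˣ) : ZMod N) = -1 := Units.coe_neg_one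
  rw [← h, MulChar.pow_apply_coe, h, hχ, one_pow]

end Even

/-! ## §3 Faithful even characters mod `2^{n+2}` are primitive, and exist -/

section Primitive

variable {S : Type*} [CommRing S] {n : ℕ} {M : ℕ} [NeZero M]

/-- **An even character mod `2^{n+2}` (`n ≥ 1`) whose value at `g = 5` is a PRIMITIVE `2^n`-th root of unity is
primitive** (conductor `2^{n+2}`): otherwise it factors through `2^{n+1}`, killing `g^{2^{n−1}}` (whose image
`5^{2^{n−1}}` in `(ℤ/2^{n+1})ˣ` is `1`, `ZMod.orderOf_five`), whereas `χ(g)^{2^{n−1}} ≠ 1`.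
[cite: Washington1997, §13.1 and Ch. 3] -/
theorem isPrimitive_of_even_of_apply_five (hn : 1 ≤ n) (hM : M = 2 ^ (n + 2)) {g : (ZMod M)ˣ}
    (hg : (g : ZMod M) = 5) {χ : DirichletCharacter S M} (hprim : IsPrimitiveRoot (χ g) (2 ^ n)) :
    χ.IsPrimitive := by
  subst hM
  rw [DirichletCharacter.isPrimitive_def]
  have hdvd := DirichletCharacter.conductor_dvd_level χ
  obtain ⟨i, hi, hci⟩ := (Nat.dvd_prime_pow Nat.prime_two).mp hdvd
  rw [hci]
  by_contra hne
  have hin : i ≤ n + 1 := by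
    have : i ≠ n + 2 := fun h ↦ hne (by rw [h])
    omega
  -- `χ` factors through `2^{n+1}`
  have hd : 2 ^ (n + 1) ∣ 2 ^ (n + 2) := pow_dvd_pow 2 (Nat.le_succ (n + 1))
  have hfac : χ.FactorsThrough (2 ^ (n + 1)) := by
    have h0 : χ.FactorsThrough (2 ^ i) := by
      rw [← hci]; exact DirichletCharacter.factorsThrough_conductor χ
    exact DirichletCharacter.FactorsThrough.mono (χ := χ) (hχ := h0) (hd := pow_dvd_pow 2 hin) (hm := hd)
  rw [DirichletCharacter.factorsThrough_iff_ker_unitsMap hd] at hfac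
  -- `g^{2^{n-1}}` dies in `(ℤ/2^{n+1})ˣ`
  obtain ⟨m, rfl⟩ : ∃ m, n = m + 1 := ⟨n - 1, by omega⟩
  have hker_u : g ^ 2 ^ m ∈ (ZMod.unitsMap hd).ker := by
    rw [MonoidHom.mem_ker, map_pow]
    have hu : ZMod.unitsMap hd g = ZMod.unitOfCoprime 5 (Nat.Coprime.pow_right _ (by norm_num)) := by
      ext
      rw [ZMod.unitsMap_val, hg, ZMod.coe_unitOfCoprime,
        show (5 : ZMod (2 ^ (m + 1 + 2))) = ((5 : ℕ) : ZMod (2 ^ (m + 1 + 2))) by norm_cast, ZMod.cast_natCast hd]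
    rw [hu, ← orderOf_dvd_iff_pow_eq_one, ← orderOf_units, ZMod.coe_unitOfCoprime, Nat.cast_ofNat,
      show m + 1 + 1 = m + 2 by ring, ZMod.orderOf_five m]
  have h1 : χ ((g ^ 2 ^ m : (ZMod (2 ^ (m + 1 + 2)))ˣ) : ZMod (2 ^ (m + 1 + 2))) = 1 := by
    have := hfac hker_u
    rw [MonoidHom.mem_ker] at this
    rw [← MulChar.coe_toUnitHom, this, Units.val_one]
  rw [Units.val_pow_eq_pow_val, map_pow] at h1
  -- but `χ(g)` has order `2^{m+1}`
  have hlt : 2 ^ m < 2 ^ (m + 1) := Nat.pow_lt_pow_right (by norm_num) (Nat.lt_succ_self m)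
  exact hprim.pow_ne_one_of_pos_of_lt (pow_pos two_pos m).ne' hlt h1

/-- **Existence of faithful even characters.** Over any commutative ring `S` (a domain) with a primitive `2^n`-th
root of unity `η`, there is an EVEN Dirichlet character `χ` mod `M = 2^{n+2}` with `χ(g) = η` (`g = 5`):
`χ(±g^k) := η^k`, well defined because every unit is uniquely `±g^k`, `k < 2^n` (§1). For `n ≥ 1` it is primitive
(`isPrimitive_of_even_of_apply_five`). [cite: Washington1997, §13.1] -/
theorem exists_even_apply_five_eq (hM : M = 2 ^ (n + 2)) {g : (ZMod M)ˣ} (hg : (g : ZMod M) = 5) {η : S}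
    (hη : IsPrimitiveRoot η (2 ^ n)) :
    ∃ χ : DirichletCharacter S M, χ.Even ∧ χ g = η := by
  have hord := orderOf_unit_five hM hg
  have hne := pow_five_ne_neg_pow hM hg
  have hdec := exists_eq_five_pow_or_eq_neg_five_pow hM hg
  have h2n : 0 < 2 ^ n := pow_pos two_pos n
  set ηu : Sˣ := (hη.isUnit h2n.ne').unit with hηu
  have hηu_val : (ηu : S) = η := (hη.isUnit h2n.ne').unit_spec
  have hηu_pow : ηu ^ 2 ^ n = 1 := by ext; rw [Units.val_pow_eq_pow_val, hηu_val, hη.pow_eq_one, Units.val_one]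
  -- the exponent of a unit: `b = ± g^{e b}` with `e b < 2^n`
  choose e he_lt he_eq using hdec
  -- uniqueness of the exponent modulo `2^n`
  have huniq : ∀ (b : (ZMod M)ˣ) (k : ℕ), (b = g ^ k ∨ b = -(g ^ k)) → ηu ^ e b = ηu ^ k := by
    intro b k hk
    have hmod : ∀ k l : ℕ, g ^ k = g ^ l → ηu ^ k = ηu ^ l := by
      intro k l h
      rw [pow_eq_pow_iff_modEq, hord] at h
      rw [pow_eq_pow_iff_modEq]
      exact h.of_dvd (orderOf_dvd_of_pow_eq_one hηu_pow)
    rcases he_eq b with h1 | h1 <;> rcases hk with h2 | h2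
    · exact hmod _ _ (h1.symm.trans h2)
    · exact absurd (h1.symm.trans h2) (hne _ _)
    · exact absurd (h2.symm.trans h1) (hne _ _)
    · exact hmod _ _ (neg_inj.mp (h1.symm.trans h2))
  -- the character on units
  let φ : (ZMod M)ˣ →* Sˣ :=
    { toFun := fun b ↦ ηu ^ e b
      map_one' := by
        have h := huniq 1 0 (Or.inl (pow_zero g).symm)
        rw [pow_zero] at h; exact h
      map_mul' := by
        intro b c
        have h := huniq (b * c) (e b + e c) ?_
        · rw [h, pow_add]
        rcases he_eq b with hb | hb <;> rcases he_eq c with hc | hc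
        · left; rw [pow_add, ← hb, ← hc]
        · right; rw [pow_add, ← mul_neg, ← hb, ← hc]
        · right; rw [pow_add, ← neg_mul, ← hb, ← hc]
        · left; rw [pow_add, ← neg_mul_neg (g ^ e b) (g ^ e c), ← hb, ← hc] }
  refine ⟨MulChar.ofUnitHom φ, ?_, ?_⟩
  · -- even: `-1 = -(g^0)` has exponent `0`
    change MulChar.ofUnitHom φ (-1) = 1
    have h : ((-1 : (ZMod M)ˣ) : ZMod M) = -1 := Units.coe_neg_one
    rw [← h, MulChar.ofUnitHom_coe, Units.val_eq_one]
    change ηu ^ e (-1) = 1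
    rw [huniq (-1) 0 (Or.inr (by rw [pow_zero])), pow_zero]
  · rw [MulChar.ofUnitHom_coe]
    change ((ηu ^ e g : Sˣ) : S) = η
    rw [huniq g 1 (Or.inl (pow_one g).symm), pow_one, hηu_val]

/-- **A primitive even Dirichlet character mod `2^{n+2}` exists at every level `n ≥ 1`** over any domain with a
primitive `2^n`-th root of unity (e.g. `ℂ`, `η = e^{2πi/2^n}`; any commutative coefficient ring): the faithful
characters of `Gal(ℚ_n/ℚ) = (ℤ/2^{n+2})ˣ/{±1} ≅ ℤ/2^n`. [cite: Washington1997, §13.1] -/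
theorem exists_even_isPrimitive (hn : 1 ≤ n) (hM : M = 2 ^ (n + 2)) {η : S} (hη : IsPrimitiveRoot η (2 ^ n)) :
    ∃ χ : DirichletCharacter S M, χ.Even ∧ χ.IsPrimitive := by
  obtain ⟨g, hg⟩ := exists_unit_eq_five (n := n) hM
  obtain ⟨χ, heven, hχg⟩ := exists_even_apply_five_eq hM hg hη
  exact ⟨χ, heven, isPrimitive_of_even_of_apply_five hn hM hg (hχg ▸ hη)⟩

end Primitive

/-! ## §4 Changing the coefficient ring along an injective ring map: conductor, parity, and LIFTING characters
whose values are roots of unity already present in the smaller ring -/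

section RingHomComp

variable {S S' : Type*} [CommRing S] [CommRing S'] {N : ℕ} [NeZero N]

/-- The conductor is unchanged by an INJECTIVE change of coefficients `f : S → S'`: a character factors through
`d` iff the kernel of `(ℤ/N)ˣ → (ℤ/d)ˣ` dies under it (Mathlib `factorsThrough_iff_ker_unitsMap`), and
`f(χ u) = 1 ↔ χ u = 1`. [cite: Washington1997, Ch. 3 (conductors)] -/
theorem conductor_ringHomComp (χ : DirichletCharacter S N) {f : S →+* S'} (hf : Function.Injective f) :
    DirichletCharacter.conductor (χ.ringHomComp f) = χ.conductor := by
  have key : ∀ d : ℕ, DirichletCharacter.FactorsThrough (χ.ringHomComp f) d ↔ χ.FactorsThrough d := by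
    intro d
    by_cases hd : d ∣ N
    · rw [DirichletCharacter.factorsThrough_iff_ker_unitsMap hd,
        DirichletCharacter.factorsThrough_iff_ker_unitsMap hd]
      have hker : ∀ u : (ZMod N)ˣ, u ∈ (MulChar.toUnitHom (χ.ringHomComp f)).ker ↔ u ∈ χ.toUnitHom.ker := by
        intro u
        rw [MonoidHom.mem_ker, MonoidHom.mem_ker, ← Units.val_eq_one, ← Units.val_eq_one,
          MulChar.coe_toUnitHom, MulChar.coe_toUnitHom, MulChar.ringHomComp_apply, ← map_one f]
        exact hf.eq_iff
      constructor
      · exact fun h u hu ↦ (hker u).mp (h hu)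
      · exact fun h u hu ↦ (hker u).mpr (h hu)
    · constructor
      · exact fun h ↦ absurd h.dvd hd
      · exact fun h ↦ absurd h.dvd hd
  have hset : DirichletCharacter.conductorSet (χ.ringHomComp f) = χ.conductorSet := by
    ext d
    rw [DirichletCharacter.mem_conductorSet_iff, DirichletCharacter.mem_conductorSet_iff, key]
  change sInf (DirichletCharacter.conductorSet (χ.ringHomComp f)) = sInf χ.conductorSet
  rw [hset]

/-- Primitivity is unchanged by an injective change of coefficients. [cite: Washington1997, Ch. 3 (conductors)] -/
theorem isPrimitive_ringHomComp_iff (χ : DirichletCharacter S N) {f : S →+* S'} (hf : Function.Injective f) :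
    DirichletCharacter.IsPrimitive (χ.ringHomComp f) ↔ χ.IsPrimitive := by
  rw [DirichletCharacter.isPrimitive_def, DirichletCharacter.isPrimitive_def, conductor_ringHomComp χ hf]

omit [NeZero N] in
/-- Parity is unchanged by an injective change of coefficients. [cite: Washington1997, Ch. 3] -/
theorem even_ringHomComp_iff (χ : DirichletCharacter S N) {f : S →+* S'} (hf : Function.Injective f) :
    DirichletCharacter.Even (χ.ringHomComp f) ↔ χ.Even := by
  change f (χ (-1)) = 1 ↔ χ (-1) = 1
  rw [← map_one f]
  exact hf.eq_iff

omit [NeZero N] in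
/-- **Lifting a character along an injective ring map.** Let `ι : F → K` be injective into a domain `K`, let `F`
contain a primitive `e`-th root of unity `ζ` (`e ≥ 1`), and suppose every unit of `ℤ/N` is killed by `e` (e.g.
`e = #(ℤ/N)ˣ`). Then EVERY Dirichlet character `χ` mod `N` with values in `K` is `χ'.ringHomComp ι` for a (unique)
character `χ'` with values in `F`: `χ(b)^e = 1`, so `χ(b) = ι(ζ)^{i(b)}` (the `e`-th roots of unity of the domain
`K` are the powers of `ι(ζ)`), and `b ↦ ζ^{i(b)}` is multiplicative because `ι` is injective. (Used with
`F = ℚ(ζ_m) → K = ℂ_p`: a `ℂ_p`-valued character mod `m` is the image of a `ℚ(ζ_m)`-valued one, whose complex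
embedding carries Kato's value law.) [cite: Washington1997, Ch. 3] -/
theorem exists_ringHomComp_eq {F K : Type*} [CommRing F] [CommRing K] [IsDomain K] {ι : F →+* K}
    (hι : Function.Injective ι) {e : ℕ} [NeZero e] {ζ : F} (hζ : IsPrimitiveRoot ζ e)
    (he : ∀ b : (ZMod N)ˣ, b ^ e = 1) (χ : DirichletCharacter K N) :
    ∃ χ' : DirichletCharacter F N, χ'.ringHomComp ι = χ := by
  have hζK : IsPrimitiveRoot (ι ζ) e := hζ.map_of_injective hι
  have hex : ∀ b : (ZMod N)ˣ, ∃ i < e, ι ζ ^ i = χ b := fun b ↦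
    hζK.eq_pow_of_pow_eq_one (by rw [← MulChar.coe_toUnitHom, ← Units.val_pow_eq_pow_val, ← map_pow, he b,
      map_one, Units.val_one])
  choose i _hi hiχ using hex
  set ζu : Fˣ := (hζ.isUnit (NeZero.ne e)).unit with hζu
  have hζu_val : (ζu : F) = ζ := (hζ.isUnit (NeZero.ne e)).unit_spec
  -- `ι (ζ^{i b}) = χ b`
  have hval : ∀ b : (ZMod N)ˣ, ι ((ζu ^ i b : Fˣ) : F) = χ b := by
    intro b
    rw [Units.val_pow_eq_pow_val, hζu_val, map_pow, hiχ]
  have hinj : ∀ x y : Fˣ, ι (x : F) = ι (y : F) → x = y := fun x y h ↦ Units.ext (hι h)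
  let φ : (ZMod N)ˣ →* Fˣ :=
    { toFun := fun b ↦ ζu ^ i b
      map_one' := hinj _ _ (by rw [hval, Units.val_one, Units.val_one, map_one, map_one])
      map_mul' := fun b c ↦ hinj _ _ (by
        rw [hval, Units.val_mul, Units.val_mul, map_mul, map_mul, hval, hval]) }
  refine ⟨MulChar.ofUnitHom φ, MulChar.ext fun b ↦ ?_⟩
  rw [MulChar.ringHomComp_apply, MulChar.ofUnitHom_coe]
  exact hval b

end RingHomComp

end LayerCharacterTwo

end Literature.NumberTheory.EllipticCurves.Kato2004

end
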